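import Summits.FinalStateConjecture.FinalStateConjecture.Theses.PhaseMixingCapture
import Summits.FinalStateConjecture.FinalStateConjecture.Theorems.PhaseMixingCaptureCaptureSufficesC2DiagonalReduction

/-!
# `CaptureSufficesTame` (crux stmt-FinalStateConjecture-17270, route `PhaseMixingCapture`, rank 6):
# logical skeleton and the shape of every counterexample

Negative-side support file of the refuter's crux attack (2026-08-16). Everything proved, no
definitions, no named facts, no instances. The crux is the curried conditional
`NearExtremalKappaCapture → BulkKerrCaptureC2 → WeakCosmicCensorshipTame → FinalStateConjecture`
(the re-typed summit BY NAME). Recorded here, kernel-checked: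

* `not_captureSufficesTame_iff`, `not_finalStateConjecture_of_not_captureSufficesTame` — the crux is
  summit-implied, so a refutation of it is both capture statements ∧ tame censorship ∧ a refutation
  of the final state conjecture itself (no cheaper kill exists; vacuity: the crux holds for free as
  soon as ANY of its three hypotheses fails);
* `captureSufficesTame_iff_censorship_iff_summit` — restates-the-target measure: modulo the two
  capture hypotheses the crux is EXACTLY `WeakCosmicCensorshipTame ↔ FinalStateConjecture`
  (the summit implies tame censorship, `tameCensorship_of_finalStateConjecture`);
* `assembly_iff_captureSufficesTame` — the route's bookkeeping `Assembly` is the crux uncurried;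
* `witness_of_wccTame_of_not_fsc`, `not_captureSufficesTame_witness` — tame port of
  `CaptureSufficesC2.Negative.CounterexampleShape`: every counterexample is an ADMISSIBLE, CENSORED
  vacuum datum (an MGHD exists, all MGHDs have complete `𝓘⁺`) with an MGHD admitting NO sub-extremal
  `C²` final-state decomposition of its self-determined exterior with rays in the closure, exhaustive
  honest charts and future orientation — a disproof must CONSTRUCT a maximal vacuum Cauchy development.

The positive implication records (`FinalStateConjecture → CaptureSufficesTame`,
`CaptureSufficesC2 → CaptureSufficesTame`, bare-handed form) are prover landings and travel as item
evidence only (refuter crux attack, `W.lean`).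
-/

-- the problem namespace `FinalStateConjecture.FinalStateConjecture` (single-conjunct summit) trips dupNamespace
set_option linter.dupNamespace false

noncomputable section

open scoped Manifold ContDiff Topology ENNReal
open Set Function

namespace Summit.FinalStateConjecture.FinalStateConjecture.Theorems.CaptureSufficesTame.Negative

open Literature.Geometry.Lorentzian
open Summit.FinalStateConjecture.FinalStateConjecture.Theses.PhaseMixingCapture
  (NearExtremalKappaCapture BulkKerrCaptureC2 WeakCosmicCensorshipTame CaptureSufficesTame Assembly)
open Summit.FinalStateConjecture.FinalStateConjecture.Theorems.PhaseMixingCaptureCaptureSufficesC2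
  (tameCensorship_of_finalStateConjecture)

/-! ## §1 The crux is summit-implied: negation shape -/

/-- A disproof of the crux is exactly: both capture statements, TAME weak cosmic censorship AND a
disproof of the summit statement (so the crux holds vacuously as soon as any hypothesis fails).
[folklore] -/
theorem not_captureSufficesTame_iff :
    ¬ CaptureSufficesTame ↔
      NearExtremalKappaCapture ∧ BulkKerrCaptureC2 ∧ WeakCosmicCensorshipTame ∧
        ¬ _root_.FinalStateConjecture := by
  unfold CaptureSufficesTame
  tauto

/-- Hence every refutation of the crux refutes the final state conjecture. [folklore] -/
theorem not_finalStateConjecture_of_not_captureSufficesTame (h : ¬ CaptureSufficesTame) :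
    ¬ _root_.FinalStateConjecture :=
  (not_captureSufficesTame_iff.1 h).2.2.2

/-! ## §2 Restates-the-target measure -/

/-- **Modulo the two capture hypotheses the crux is `tame censorship ↔ final state`** (the summit
implies its own third hypothesis, `tameCensorship_of_finalStateConjecture`). [folklore] -/
theorem captureSufficesTame_iff_censorship_iff_summit :
    CaptureSufficesTame ↔
      (NearExtremalKappaCapture → BulkKerrCaptureC2 →
        (WeakCosmicCensorshipTame ↔ _root_.FinalStateConjecture)) := by
  unfold CaptureSufficesTame
  constructor
  · exact fun h h₁ h₂ ↦ ⟨h h₁ h₂, fun hF X _ _ _ _ _ _ ↦ tameCensorship_of_finalStateConjecture hF X⟩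
  · exact fun h h₁ h₂ h₃ ↦ (h h₁ h₂).1 h₃

/-- The route's bookkeeping item `Assembly` is the crux uncurried. [folklore] -/
theorem assembly_iff_captureSufficesTame : Assembly ↔ CaptureSufficesTame := by
  unfold Assembly CaptureSufficesTame
  tauto

/-! ## §3 Shape of every counterexample -/

/-- Bookkeeping: from "an MGHD exists, all MGHDs are complete, but not all MGHDs are complete AND
decomposed" extract an MGHD that is not decomposed. -/
private theorem exists_max_not_dec {α : Type*} {Max Comp Dec : α → Prop} (hex : ∃ x, Max x)
    (hcomp : ∀ x, Max x → Comp x) (hnot : ¬ ((∃ x, Max x) ∧ ∀ x, Max x → Comp x ∧ Dec x)) :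
    ∃ x, Max x ∧ ¬ Dec x := by
  by_contra hno
  push Not at hno
  exact hnot ⟨hex, fun x hx ↦ ⟨hcomp x hx, hno x hx⟩⟩

/-- **From TAME censorship and a failure of the re-typed summit to the witness.** Tame weak cosmic
censorship (MGHD form) and `¬ FinalStateConjecture` together yield a `3`-manifold and an ADMISSIBLE,
CENSORED vacuum datum on it with an MGHD admitting NO sub-extremal `C²` final-state decomposition of
its self-determined exterior with rays staying in the closure, exhaustive honest charts and
future-oriented chart times. (If the exceptional datum of `¬ FinalStateConjecture` is not itself
censored, the TAME admissible curve through it supplied by censorship is the curve the summit asks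
for unless one of its members off `0` is a censored exceptional datum.) [folklore] -/
theorem witness_of_wccTame_of_not_fsc (hW : WeakCosmicCensorshipTame)
    (hF : ¬ _root_.FinalStateConjecture) :
    ∃ (X : Type) (_ : TopologicalSpace X) (_ : ChartedSpace E3 X)
      (_ : IsManifold (𝓡 3) ((⊤ : ℕ∞) : WithTop ℕ∞) X) (_ : T2Space X)
      (_ : SecondCountableTopology X) (_ : ConnectedSpace X) (D : InitialDataSet (𝓡 3) X),
      D ∈ admissibleVacuumData X ∧
      ((∃ 𝒟 : VacuumCauchyDevelopment D, 𝒟.IsMaximal) ∧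
        ∀ 𝒟 : VacuumCauchyDevelopment D, 𝒟.IsMaximal →
          _root_.Summit.FinalStateConjecture.HasCompleteNullInfinity 𝒟.toCauchyDevelopment) ∧
      ∃ 𝒟 : VacuumCauchyDevelopment D, 𝒟.IsMaximal ∧
        ¬ ∃ (O : Set 𝒟.carrier) (d : FinalStateDecomposition 𝒟.toSpacetime O 2),
          (∀ i, Kerr.IsSubextremal (d.mass i) (d.spin i)) ∧
            O = _root_.Summit.FinalStateConjecture.exteriorOf 𝒟.toCauchyDevelopment d.charted ∧
              _root_.Summit.FinalStateConjecture.RaysStayInClosure 𝒟.toCauchyDevelopment O ∧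
                _root_.Summit.FinalStateConjecture.HasExhaustiveCharts d ∧
                  _root_.Summit.FinalStateConjecture.IsFutureOriented d := by
  by_contra hcon
  apply hF
  intro X _ _ _ _ _ _ D hD
  by_cases hPw : (∃ 𝒟 : VacuumCauchyDevelopment D, 𝒟.IsMaximal) ∧
      ∀ 𝒟 : VacuumCauchyDevelopment D, 𝒟.IsMaximal →
        _root_.Summit.FinalStateConjecture.HasCompleteNullInfinity 𝒟.toCauchyDevelopment
  · exact absurd ⟨X, ‹_›, ‹_›, ‹_›, ‹_›, ‹_›, ‹_›, D, hD.1, hPw,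
      exists_max_not_dec hPw.1 hPw.2 hD.2⟩ hcon
  · obtain ⟨e, F, hFt, hFimm, hF0, hFi, hFadm, hFgood⟩ := hW X D ⟨hD.1, hPw⟩
    refine ⟨e, F, hFt, hFimm, hF0, hFi, hFadm, fun c hc hmem ↦ ?_⟩
    have hPw' : (∃ 𝒟 : VacuumCauchyDevelopment (F c), 𝒟.IsMaximal) ∧
        ∀ 𝒟 : VacuumCauchyDevelopment (F c), 𝒟.IsMaximal →
          _root_.Summit.FinalStateConjecture.HasCompleteNullInfinity 𝒟.toCauchyDevelopment := by
      by_contra hn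
      exact hFgood c hc ⟨hFadm c, hn⟩
    exact hcon ⟨X, ‹_›, ‹_›, ‹_›, ‹_›, ‹_›, ‹_›, F c, hFadm c, hPw',
      exists_max_not_dec hPw'.1 hPw'.2 hmem.2⟩

/-- **Shape of every counterexample to the crux**: an admissible censored vacuum datum with a
non-decomposable MGHD (re-typed conclusion) — a disproof must CONSTRUCT a maximal vacuum Cauchy
development with complete `𝓘⁺`. [folklore] -/
theorem not_captureSufficesTame_witness (h : ¬ CaptureSufficesTame) :
    ∃ (X : Type) (_ : TopologicalSpace X) (_ : ChartedSpace E3 X)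
      (_ : IsManifold (𝓡 3) ((⊤ : ℕ∞) : WithTop ℕ∞) X) (_ : T2Space X)
      (_ : SecondCountableTopology X) (_ : ConnectedSpace X) (D : InitialDataSet (𝓡 3) X),
      D ∈ admissibleVacuumData X ∧
      ((∃ 𝒟 : VacuumCauchyDevelopment D, 𝒟.IsMaximal) ∧
        ∀ 𝒟 : VacuumCauchyDevelopment D, 𝒟.IsMaximal →
          _root_.Summit.FinalStateConjecture.HasCompleteNullInfinity 𝒟.toCauchyDevelopment) ∧
      ∃ 𝒟 : VacuumCauchyDevelopment D, 𝒟.IsMaximal ∧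
        ¬ ∃ (O : Set 𝒟.carrier) (d : FinalStateDecomposition 𝒟.toSpacetime O 2),
          (∀ i, Kerr.IsSubextremal (d.mass i) (d.spin i)) ∧
            O = _root_.Summit.FinalStateConjecture.exteriorOf 𝒟.toCauchyDevelopment d.charted ∧
              _root_.Summit.FinalStateConjecture.RaysStayInClosure 𝒟.toCauchyDevelopment O ∧
                _root_.Summit.FinalStateConjecture.HasExhaustiveCharts d ∧
                  _root_.Summit.FinalStateConjecture.IsFutureOriented d := by
  obtain ⟨-, -, hW, hF⟩ := not_captureSufficesTame_iff.1 h
  exact witness_of_wccTame_of_not_fsc hW hF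

end Summit.FinalStateConjecture.FinalStateConjecture.Theorems.CaptureSufficesTame.Negative

end
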